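import Literature.MathematicalPhysics.QuantumFieldTheory.BalabanImbrieJaffe1984to88.BIJ88SmallBlockFields332
import Literature.MathematicalPhysics.QuantumFieldTheory.BalabanImbrieJaffe1984to88.BIJ88BgInvariance416Torus
import Literature.MathematicalPhysics.QuantumFieldTheory.BalabanImbrieJaffe1984to88.BIJ88Sect3Translations

/-!
# `BalabanImbrieJaffe1984to88.BIJ88ScalarForms329Record` — T. Bałaban, J. Imbrie, A. Jaffe, *Effective action and cluster properties of the
abelian Higgs model*, Commun. Math. Phys. **114** (1988) 257–315 [BalabanImbrieJaffe1988], p. 270 **(3.29)**: *"The expansion yields for the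
scalar field forms ½aL^{−2}⟨ψ − Q(u)φ, ψ − Q(u)φ⟩ + ½⟨φ, −Δ_uφ⟩ = ½aL^{−2}⟨ψ − Q(u₁)φ, ψ − Q(u₁)φ⟩ + ½⟨φ, −Δ_{u₁}φ⟩ + R^{(0)}(u₁, θ₀A^{(0)}) +
Σ_□ W₁^{(0)}(□), (3.29) where R^{(0)} contains the first n̄ orders in A^{(0)} (or in e₀) and the higher order, irrelevant, local terms are
incorporated in W₁^{(0)}(□)."* — r18's typed displays `BIJ88Sect3Translations.scalarForms` / `rem329` / `eq329` AT THE OBJECTS OF RECORD on the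
torus carrier: the data slot `Q` = the covariant block average (2.6) of [BalabanImbrieJaffe1985] (`BIJ85BlockAveragesTorus.qCov`, read on
ℂ-valued bond fields through p34's `BIJ88BgInvariance416Torus.toU1Field`), the data slot `lapForm` = the kinetic form `⟨φ, −Δ_uφ⟩ = Σ_b |(D_uφ)(b)|²`
of (3.3) (`BIJ88Sect3Statements.covD`, p. 265 *"Here −Δ^ε_u = D^{ε*}_u D^ε_u"*).

statement-level skeleton of published theorems with citation tags; proofs where landed; nothing here is a claim about the Yang–Mills mass gap

PDF held: `paper:balaban1988-cmp114-bij-abelian-higgs-effective-action` (journal page = PDF page + 256); p. 270 [PDF 14] read AS AN IMAGE this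
session (`pub-balaban/b2b-balaban-ref1/tools/g4png.py` render, seat folder `work/render/…-p014-x2.png`).

CITATION HEADER (lean-in-tree rule).  Part of the lit-balaban TYPED SKELETON (HOME `run/shared/lean/pub/lit-balaban/`), PHASE-2 proof seat p30
gen 32 (unit `lit-balaban-p30`; TAKING #2 HOME/STATUS.md 2026-08-23T12:22:59Z).  WHAT IS REPRODUCED: the MEMBER OWED [S] of row **C2.Eq3.29**
named by the fold owner's audit (`HOME/lit-balaban-r18/AUDIT-C2S14-DEF-g26.md`: *«instance at `qCov`/(3.3)՚s kinetic form»*): two small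
definitions with bodies — the instantiated data slots `qRec` (= `qCov ∘ toU1Field`, so that `qRec (cfg U) = qCov U`, `qRec_cfg`) and `lapRec`
(`lapRec u φ = Σ_b ‖covD 1 u φ b‖²`) — and the kernel theorems identifying print's instance: `scalarForms_record_cfg` (at `u = cfg U` the left side of
(3.29) IS `½aL^{−2}Σ_y‖ψ(y) − (Q(u)φ)(y)‖² + ½Σ_b‖(D_uφ)(b)‖²`), its nonnegativity, its GAUGE INVARIANCE under `(u, φ, ψ) ↦ (u^h, hφ, (h∘corner)·ψ)`
([BalabanImbrieJaffe1985] (2.8) `qCov_gaugeAct_twist` + `BIJ88SmallBlockFields332.norm_covD_gaugeAct_twist`; p. 258: the action is gauge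
invariant), and the remainder `rem329` (= `R^{(0)} + Σ_□W₁^{(0)}(□)`, DEFINED by r18 as the difference of the forms at `u` and at the background
`u₁`) at the instance, with its joint gauge invariance.  NOT DONE (stays untyped, audit size [L]): the split of the remainder by order in
`θ₀A^{(0)}` (the deferred perturbation expansion).  The background `u₁` itself ((3.28) / p. 270) is rows C2.Eq3.27/3.28 (p29's
`BIJ88SecondTranslation327Torus`); here `u₁ = cfg U₁` is any `U(1)` field.

Two `def`s with bodies (`qRec`, `lapRec`), no `def … : Prop`, no `sorry`.  Axioms: {propext, Classical.choice, Quot.sound}.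
Unit `lit-balaban-p30` gen 32 (literature-prover-lit-balaban-p30-g32-0), 2026-08-23.
-/

namespace Literature.MathematicalPhysics.QuantumFieldTheory.BalabanImbrieJaffe1984to88.BIJ88ScalarForms329Record

open Literature.MathematicalPhysics.QuantumFieldTheory.Balaban1983to89
open BIJ88Sect3Statements (U1 toC toC_mul toC_one norm_toC cfg covD)
open BIJ85Sect1Model (HiggsField)
open BIJ85RT33 (twist)
open BIJ85BlockAveragesTorus (corner qCov qCov_gaugeAct_twist toC_ne_zero)
open BIJ88BgInvariance416Torus (toU1Field toU1Field_cfg)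
open BIJ88Sect3Translations (scalarForms rem329 eq329)
open BIJ88SmallBlockFields332 (norm_covD_gaugeAct_twist)
open GaugeField (gaugeAct)
open scoped BigOperators
open Complex Finset

noncomputable section

variable {P : Params} {j : ℕ}

/-! ## §0  The instantiated data slots of (3.29) -/

/-- **The data slot `Q` of (3.29) at the objects of record**: the covariant block average `Q(u)φ` of [BalabanImbrieJaffe1985] (2.6)
(`BIJ85BlockAveragesTorus.qCov`) as a function of a ℂ-VALUED bond field `u` (the type of r18's slot), read through p34's `toU1Field`
(`u_b ↦ e^{i arg u_b}`; the identity on the `U(1)` configurations of record, `qRec_cfg`). [cite: BalabanImbrieJaffe1985, (2.6) p.303] -/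
def qRec (u : PBond P j → ℂ) (φ : Balaban1983to89.Site P j → ℂ) : Balaban1983to89.Site P (j + 1) → ℂ :=
  qCov (toU1Field u) φ

/-- **The data slot `lapForm` of (3.29) at the objects of record**: the kinetic form `⟨φ, −Δ_uφ⟩ = Σ_b |(D_uφ)(b)|²` of (3.3) on the unit
lattice (p. 265: *"Here −Δ^ε_u = D^{ε*}_u D^ε_u"*, `D_uφ = covD 1 u φ`). [cite: BalabanImbrieJaffe1988, (3.3) p.265] -/
def lapRec (u : PBond P j → ℂ) (φ : Balaban1983to89.Site P j → ℂ) : ℝ :=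
  ∑ b : PBond P j, ‖covD 1 u φ b‖ ^ 2

/-- kernel: on a `U(1)` configuration of record the slot `Q` IS (2.6): `qRec (cfg U) = Q(u)`. [cite: BalabanImbrieJaffe1985, (2.6) p.303] -/
theorem qRec_cfg (U : GaugeField P j U1) (φ : Balaban1983to89.Site P j → ℂ) : qRec (cfg U) φ = qCov U φ := by
  rw [qRec, toU1Field_cfg]

/-- kernel: the value of the kinetic slot. [cite: BalabanImbrieJaffe1988, (3.3) p.265] -/
theorem lapRec_apply (u : PBond P j → ℂ) (φ : Balaban1983to89.Site P j → ℂ) : lapRec u φ = ∑ b : PBond P j, ‖covD 1 u φ b‖ ^ 2 := rfl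

/-- kernel: the kinetic slot is nonnegative. [cite: BalabanImbrieJaffe1988, (3.3) p.265] -/
theorem lapRec_nonneg (u : PBond P j → ℂ) (φ : Balaban1983to89.Site P j → ℂ) : 0 ≤ lapRec u φ :=
  sum_nonneg fun _ _ => by positivity

/-! ## §1  (3.29), left side, at the objects of record -/

/-- **(3.29) at the objects of record** — print's instance of r18's parametric display IDENTIFIED: for a `U(1)` field `u = cfg U`, scalar field
`φ` and block field `ψ`, *"the scalar field forms ½aL^{−2}⟨ψ − Q(u)φ, ψ − Q(u)φ⟩ + ½⟨φ, −Δ_uφ⟩"* typed as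
`scalarForms a L Q lapForm u φ ψ` with the slots `Q = qRec`, `lapForm = lapRec` EQUAL `½aL^{−2}Σ_y‖ψ(y) − (Q(u)φ)(y)‖² + ½Σ_b‖(D_uφ)(b)‖²` with
`Q(u)φ = BIJ85BlockAveragesTorus.qCov U φ` ((2.6)) and `D_uφ = covD 1 (cfg U) φ` ((3.3)). [cite: BalabanImbrieJaffe1988, (3.29) p.270] -/
theorem scalarForms_record_cfg (a L : ℝ) (U : GaugeField P j U1) (φ : Balaban1983to89.Site P j → ℂ) (ψ : Balaban1983to89.Site P (j + 1) → ℂ) :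
    scalarForms a L qRec lapRec (cfg U) φ ψ =
      (1 / 2) * a * L ^ (-(2 : ℤ)) * (∑ y : Balaban1983to89.Site P (j + 1), ‖ψ y - qCov U φ y‖ ^ 2) +
        (1 / 2) * ∑ b : PBond P j, ‖covD 1 (cfg U) φ b‖ ^ 2 := by
  simp only [scalarForms, qRec_cfg, lapRec_apply]

/-- **The (3.29) forms are nonnegative** at the objects of record for `a ≥ 0` (both terms are sums of squares; `L^{−2} = (L²)⁻¹ ≥ 0`).
[cite: BalabanImbrieJaffe1988, (3.29) p.270] -/
theorem scalarForms_record_nonneg {a : ℝ} (ha : 0 ≤ a) (L : ℝ) (U : GaugeField P j U1) (φ : Balaban1983to89.Site P j → ℂ)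
    (ψ : Balaban1983to89.Site P (j + 1) → ℂ) : 0 ≤ scalarForms a L qRec lapRec (cfg U) φ ψ := by
  rw [scalarForms_record_cfg]
  have hL : 0 ≤ L ^ (-(2 : ℤ)) := by
    rw [show (-(2 : ℤ)) = -((2 : ℕ) : ℤ) from rfl, zpow_neg, zpow_natCast]
    positivity
  have h1 : 0 ≤ ∑ y : Balaban1983to89.Site P (j + 1), ‖ψ y - qCov U φ y‖ ^ 2 := sum_nonneg fun _ _ => by positivity
  have h2 : 0 ≤ ∑ b : PBond P j, ‖covD 1 (cfg U) φ b‖ ^ 2 := sum_nonneg fun _ _ => by positivity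
  positivity

/-! ## §2  Gauge invariance of the instantiated forms -/

/-- **The (3.29) forms at the objects of record are GAUGE INVARIANT** under `(u, φ, ψ) ↦ (u^h, hφ, (h∘corner)·ψ)` — the joint gauge action of
[BalabanImbrieJaffe1985] (2.7) on `(u, φ)` and, on the block field, multiplication by `h` at the block corners (the coarse sites): by (2.8)
`Q(u^h)(hφ) = h(y)·Q(u)φ` (`qCov_gaugeAct_twist`) the first form is unchanged term by term, and `|D_{u^h}(hφ)| = |D_uφ|`
(`BIJ88SmallBlockFields332.norm_covD_gaugeAct_twist`) — p. 258: the action (3.3) *"is a gauge invariant function of u, φ"* [sic: of `F`;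
the action by `BIJ88Sect3Statements.action_gauge`]. [cite: BalabanImbrieJaffe1988, (3.29) p.270] -/
theorem scalarForms_record_gaugeAct (hj : j + 1 ≤ P.m + P.K) (a L : ℝ) (h : GaugeTransf P j U1) (U : GaugeField P j U1)
    (φ : Balaban1983to89.Site P j → ℂ) (ψ : Balaban1983to89.Site P (j + 1) → ℂ) :
    scalarForms a L qRec lapRec (cfg (gaugeAct h U)) (twist h φ) (fun y => toC (h (corner y)) * ψ y) =
      scalarForms a L qRec lapRec (cfg U) φ ψ := by
  rw [scalarForms_record_cfg, scalarForms_record_cfg]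
  congr 1
  · congr 1
    refine sum_congr rfl fun y _ => ?_
    rw [qCov_gaugeAct_twist hj, ← mul_sub, norm_mul, norm_toC, one_mul]
  · congr 1
    exact sum_congr rfl fun b _ => by rw [norm_covD_gaugeAct_twist]

/-! ## §3  The remainder `R^{(0)} + Σ_□W₁^{(0)}(□)` of (3.29) at the objects of record -/

/-- **The remainder of (3.29) at the objects of record** (r18's `rem329`: *"the display DEFINES the expansion terms R^{(0)} + Σ_□W₁^{(0)}(□)
collectively as the difference of the forms at u and at the background u₁"*): for `U(1)` fields `u = cfg U`, `u₁ = cfg U₁` it is the explicit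
difference `½aL^{−2}Σ_y(‖ψ − Q(u)φ‖² − ‖ψ − Q(u₁)φ‖²)(y) + ½Σ_b(‖D_uφ‖² − ‖D_{u₁}φ‖²)(b)`. [cite: BalabanImbrieJaffe1988, (3.29) p.270] -/
theorem rem329_record (a L : ℝ) (U U₁ : GaugeField P j U1) (φ : Balaban1983to89.Site P j → ℂ) (ψ : Balaban1983to89.Site P (j + 1) → ℂ) :
    rem329 a L qRec lapRec (cfg U) (cfg U₁) φ ψ =
      (1 / 2) * a * L ^ (-(2 : ℤ)) * (∑ y : Balaban1983to89.Site P (j + 1), (‖ψ y - qCov U φ y‖ ^ 2 - ‖ψ y - qCov U₁ φ y‖ ^ 2)) +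
        (1 / 2) * ∑ b : PBond P j, (‖covD 1 (cfg U) φ b‖ ^ 2 - ‖covD 1 (cfg U₁) φ b‖ ^ 2) := by
  rw [rem329, scalarForms_record_cfg, scalarForms_record_cfg, sum_sub_distrib, sum_sub_distrib]
  ring

/-- **(3.29) as displayed, at the objects of record**: forms at `u` = forms at `u₁` + (R^{(0)} + ΣW₁^{(0)}) (r18's `eq329` at the instance).
[cite: BalabanImbrieJaffe1988, (3.29) p.270] -/
theorem eq329_record (a L : ℝ) (U U₁ : GaugeField P j U1) (φ : Balaban1983to89.Site P j → ℂ) (ψ : Balaban1983to89.Site P (j + 1) → ℂ) :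
    scalarForms a L qRec lapRec (cfg U) φ ψ = scalarForms a L qRec lapRec (cfg U₁) φ ψ + rem329 a L qRec lapRec (cfg U) (cfg U₁) φ ψ :=
  eq329 a L qRec lapRec (cfg U) (cfg U₁) φ ψ

/-- kernel: at `u₁ = u` the remainder vanishes. [cite: BalabanImbrieJaffe1988, (3.29) p.270] -/
theorem rem329_record_self (a L : ℝ) (U : GaugeField P j U1) (φ : Balaban1983to89.Site P j → ℂ) (ψ : Balaban1983to89.Site P (j + 1) → ℂ) :
    rem329 a L qRec lapRec (cfg U) (cfg U) φ ψ = 0 := by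
  rw [rem329, sub_self]

/-- **The remainder is jointly gauge invariant**: transforming `u`, `u₁`, `φ`, `ψ` together by `h` leaves `R^{(0)} + ΣW₁^{(0)}` unchanged
(`scalarForms_record_gaugeAct` at `u` and at `u₁`). [cite: BalabanImbrieJaffe1988, (3.29) p.270] -/
theorem rem329_record_gaugeAct (hj : j + 1 ≤ P.m + P.K) (a L : ℝ) (h : GaugeTransf P j U1) (U U₁ : GaugeField P j U1)
    (φ : Balaban1983to89.Site P j → ℂ) (ψ : Balaban1983to89.Site P (j + 1) → ℂ) :
    rem329 a L qRec lapRec (cfg (gaugeAct h U)) (cfg (gaugeAct h U₁)) (twist h φ) (fun y => toC (h (corner y)) * ψ y) =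
      rem329 a L qRec lapRec (cfg U) (cfg U₁) φ ψ := by
  rw [rem329, rem329, scalarForms_record_gaugeAct hj, scalarForms_record_gaugeAct hj]

end

end Literature.MathematicalPhysics.QuantumFieldTheory.BalabanImbrieJaffe1984to88.BIJ88ScalarForms329Record
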